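import Mathlib
import Literature.Probability.RandomMatrix.TwoQubitSeparabilityVolumesQubitFibreProofs
import HarnessLib

/-!
# Schur sections of the two-sided cone `0 ≼ ρ ≼ ½` over a `3 × 3` corner
# (step A of the "secular peeling" of Zhang–Jiang–Xie 2025, Prop. 6.10)

For a `3 × 3` Hermitian corner `ρ₃ = U diag(e) U*` with spectrum `0 < eᵢ < ½` and a real corner
entry `c`, the set of border columns `v ∈ ℂ³` for which the bordered `4 × 4` matrix
`ρ = [[ρ₃, v], [v*, c]]` satisfies `0 ≼ ρ` AND `½·1 − ρ ≽ 0` is, by two Schur complements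
(`Matrix.PosDef.fromBlocks₁₁`), the intersection of the two CO-AXIAL solid ellipsoids
`v* ρ₃⁻¹ v ≤ c` and `v* (½ − ρ₃)⁻¹ v ≤ ½ − c` (the two forms commute), i.e. in the eigenbasis of
`ρ₃` and with `sᵢ = |uᵢ|²` the polytope
`cutSimplex e c = {s ≥ 0 : Σ sᵢ/eᵢ ≤ c, Σ sᵢ/(½ − eᵢ) ≤ ½ − c}` (a simplex cut by a half-space).
Consequently (`volume_schurSection`)

  `vol₆ {v : 0 ≼ ρ ≼ ½} = π³ · vol₃ (cutSimplex e c)`,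

the factor `π³` being the push-forward of Lebesgue measure on `ℂ³` under `u ↦ (|uᵢ|²)ᵢ`
(`volume_normSq_preimage`, from the tree's `lintegral_comp_normSq`) and the eigenbasis rotation
`v = U u` being measure preserving (`|det_ℝ U| = |det_ℂ U|² = 1`, `LinearMap.det_restrictScalars`).
This is the innermost step of an elementary evaluation of the Hilbert–Schmidt volume of the
two-qubit `λ_max ≤ ½` fibres [ZhangJiangXie2025, Prop. 6.10] (printed proof: Duistermaat–Heckman
measure); everything here is folklore linear algebra and measure theory, no named facts.

## References

* [ZhangJiangXie2025] L. Zhang, X. Jiang, B. Xie, Quantum Inf. Comput. 25 (2025) 598–632 =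
  arXiv:2507.02369, §6.2 Prop. 6.10.
-/

noncomputable section

open _root_.MeasureTheory Set Real
open scoped ENNReal ComplexConjugate ComplexOrder Matrix
open Complex Matrix

namespace Literature.Probability.RandomMatrix

namespace ZhangJiangXie2025

/-! ## A1. Push-forward of Lebesgue measure on `ℂ³` under `u ↦ (|uᵢ|²)ᵢ` -/

/-- `(normSq)_* vol_ℂ = π · vol|_{(0,∞)}`. [folklore] -/
theorem map_normSq_volume :
    Measure.map Complex.normSq (volume : Measure ℂ) =
      ENNReal.ofReal π • (volume : Measure ℝ).restrict (Ioi 0) := by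
  have hm : Measurable Complex.normSq := Complex.continuous_normSq.measurable
  ext s hs
  rw [Measure.map_apply hm hs, Measure.smul_apply, smul_eq_mul, ← lintegral_indicator_one hs,
    ← lintegral_indicator_one (hm hs)]
  have h := lintegral_comp_normSq (s.indicator 1) ((measurable_indicator_const_iff 1).mpr hs)
  have hind : ∀ z : ℂ, s.indicator (1 : ℝ → ℝ≥0∞) (Complex.normSq z) =
      (Complex.normSq ⁻¹' s).indicator 1 z := by
    intro z
    by_cases hz : Complex.normSq z ∈ s
    · rw [Set.indicator_of_mem hz, Set.indicator_of_mem (Set.mem_preimage.mpr hz)]; rfl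
    · rw [Set.indicator_of_notMem hz, Set.indicator_of_notMem (fun h' => hz (Set.mem_preimage.mp h'))]
  simp_rw [hind] at h
  rw [h]

/-- The coordinatewise squared-modulus map `ℂ³ → ℝ³`. [folklore] -/
def normSqPi (u : Fin 3 → ℂ) : Fin 3 → ℝ := fun i => Complex.normSq (u i)

/-- `normSqPi` is measurable. [folklore] -/
theorem measurable_normSqPi : Measurable normSqPi :=
  measurable_pi_lambda _ fun i => Complex.continuous_normSq.measurable.comp (measurable_pi_apply i)

/-- `π · vol|_{(0,∞)}` is σ-finite (the scalar is finite). [folklore] -/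
instance sigmaFinite_pi_smul_restrict_Ioi :
    SigmaFinite (ENNReal.ofReal π • (volume : Measure ℝ).restrict (Ioi 0)) := by
  rw [show ENNReal.ofReal π = ((Real.toNNReal π : NNReal) : ℝ≥0∞) from rfl, ← ENNReal.smul_def]
  infer_instance

/-- Product of three copies of `π · vol|_{(0,∞)}`. [folklore] -/
theorem pi_smul_restrict_Ioi :
    Measure.pi (fun _ : Fin 3 => ENNReal.ofReal π • (volume : Measure ℝ).restrict (Ioi 0)) =
      ENNReal.ofReal π ^ 3 • Measure.pi (fun _ : Fin 3 => (volume : Measure ℝ).restrict (Ioi 0)) := by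
  refine Measure.pi_eq
    (μ := fun _ : Fin 3 => ENNReal.ofReal π • (volume : Measure ℝ).restrict (Ioi 0))
    fun s _ => ?_
  rw [Measure.smul_apply, smul_eq_mul, Measure.pi_pi]
  simp only [Measure.smul_apply, smul_eq_mul, Finset.prod_mul_distrib, Finset.prod_const,
    Finset.card_univ, Fintype.card_fin]

/-- `(normSqPi)_* vol_{ℂ³} = π³ · vol|_{(0,∞)³}`. [folklore] -/
theorem map_normSqPi_volume :
    Measure.map normSqPi (volume : Measure (Fin 3 → ℂ)) =
      ENNReal.ofReal π ^ 3 • (volume : Measure (Fin 3 → ℝ)).restrict (univ.pi fun _ => Ioi 0) := by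
  have hm : Measurable Complex.normSq := Complex.continuous_normSq.measurable
  have hsf : ∀ _i : Fin 3, SigmaFinite ((volume : Measure ℂ).map Complex.normSq) := fun _ => by
    rw [map_normSq_volume]; infer_instance
  rw [show normSqPi = fun (u : Fin 3 → ℂ) (i : Fin 3) => Complex.normSq (u i) from rfl,
    volume_pi, Measure.pi_map_pi (hμ := hsf) (fun _ => hm.aemeasurable)]
  simp_rw [map_normSq_volume]
  rw [pi_smul_restrict_Ioi, ← Measure.restrict_pi_pi, volume_pi]

/-- **Push-forward under `u ↦ (|uᵢ|²)ᵢ`**: for measurable `T ⊆ ℝ³`,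
`vol₆ {u ∈ ℂ³ : (|uᵢ|²)ᵢ ∈ T} = π³ · vol₃ (T ∩ (0,∞)³)`. [folklore] -/
theorem volume_normSqPi_preimage {T : Set (Fin 3 → ℝ)} (hT : MeasurableSet T) :
    volume (normSqPi ⁻¹' T) = ENNReal.ofReal π ^ 3 * volume (T ∩ univ.pi fun _ => Ioi 0) := by
  rw [← Measure.map_apply measurable_normSqPi hT, map_normSqPi_volume, Measure.smul_apply,
    smul_eq_mul, Measure.restrict_apply hT]

/-! ## A2. The cut simplex -/

/-- The polytope `{s ≥ 0 : Σ sᵢ/eᵢ ≤ c, Σ sᵢ/(½ − eᵢ) ≤ ½ − c}` — a corner simplex cut by a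
half-space — whose volume is the Schur section volume divided by `π³`. [folklore] -/
def cutSimplex (e : Fin 3 → ℝ) (c : ℝ) : Set (Fin 3 → ℝ) :=
  {s | (∀ i, 0 ≤ s i) ∧ ∑ i, s i / e i ≤ c ∧ ∑ i, s i / (1 / 2 - e i) ≤ 1 / 2 - c}

/-- `cutSimplex` is measurable (closed). [folklore] -/
theorem measurableSet_cutSimplex (e : Fin 3 → ℝ) (c : ℝ) : MeasurableSet (cutSimplex e c) := by
  have h1 : MeasurableSet {s : Fin 3 → ℝ | ∀ i, 0 ≤ s i} := by
    have : {s : Fin 3 → ℝ | ∀ i, 0 ≤ s i} = ⋂ i, {s | 0 ≤ s i} := by ext s; simp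
    rw [this]
    exact MeasurableSet.iInter fun i => measurableSet_le measurable_const (measurable_pi_apply i)
  have h2 : MeasurableSet {s : Fin 3 → ℝ | ∑ i, s i / e i ≤ c} :=
    measurableSet_le (Finset.measurable_sum _ fun i _ => (measurable_pi_apply i).div_const _)
      measurable_const
  have h3 : MeasurableSet {s : Fin 3 → ℝ | ∑ i, s i / (1 / 2 - e i) ≤ 1 / 2 - c} :=
    measurableSet_le (Finset.measurable_sum _ fun i _ => (measurable_pi_apply i).div_const _)
      measurable_const
  unfold cutSimplex
  rw [Set.setOf_and, Set.setOf_and]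
  exact h1.inter (h2.inter h3)

/-- The points of `cutSimplex e c` with a vanishing coordinate form a null set. [folklore] -/
theorem volume_cutSimplex_inter_pos (e : Fin 3 → ℝ) (c : ℝ) :
    volume (cutSimplex e c ∩ univ.pi fun _ => Ioi (0 : ℝ)) = volume (cutSimplex e c) := by
  apply measure_congr
  have hnull : ∀ i : Fin 3, volume {s : Fin 3 → ℝ | s i = 0} = 0 := by
    intro i
    rw [volume_pi]
    exact Measure.pi_hyperplane _ i 0
  have hsub : (cutSimplex e c \ (cutSimplex e c ∩ univ.pi fun _ => Ioi (0 : ℝ))) ⊆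
      ⋃ i : Fin 3, {s : Fin 3 → ℝ | s i = 0} := by
    intro s hs
    obtain ⟨hsC, hsn⟩ := hs
    simp only [mem_inter_iff, mem_univ_pi, mem_Ioi, not_and, not_forall, not_lt] at hsn
    obtain ⟨i, hi⟩ := hsn hsC
    exact mem_iUnion.mpr ⟨i, le_antisymm hi (hsC.1 i)⟩
  refine (ae_eq_set.mpr ⟨?_, ?_⟩)
  · have h0 : (cutSimplex e c ∩ univ.pi fun _ => Ioi (0 : ℝ)) \ cutSimplex e c = ∅ := by
      ext s
      constructor
      · rintro ⟨⟨hs1, -⟩, hs2⟩; exact (hs2 hs1).elim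
      · intro hs; exact hs.elim
    rw [h0]; exact measure_empty
  · exact measure_mono_null hsub ((measure_iUnion_null_iff).mpr hnull)

/-! ## A3. The bordered block matrix and its Schur complements -/

/-- A vector as a `3 × 1` column matrix. [folklore] -/
def colv (v : Fin 3 → ℂ) : Matrix (Fin 3) (Fin 1) ℂ := Matrix.of fun i _ => v i

/-- The bordered block matrix `[[A, v], [v*, c]]` on `Fin 3 ⊕ Fin 1`. [folklore] -/
def blk (A : Matrix (Fin 3) (Fin 3) ℂ) (v : Fin 3 → ℂ) (c : ℂ) :
    Matrix (Fin 3 ⊕ Fin 1) (Fin 3 ⊕ Fin 1) ℂ :=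
  Matrix.fromBlocks A (colv v) (colv v)ᴴ !![c]

/-- `½·1 − [[A, v], [v*, c]] = [[½ − A, −v], [−v*, ½ − c]]`. [folklore] -/
theorem half_sub_blk (A : Matrix (Fin 3) (Fin 3) ℂ) (v : Fin 3 → ℂ) (c : ℂ) :
    (2 : ℂ)⁻¹ • (1 : Matrix (Fin 3 ⊕ Fin 1) (Fin 3 ⊕ Fin 1) ℂ) - blk A v c =
      blk ((2 : ℂ)⁻¹ • 1 - A) (-v) ((2 : ℂ)⁻¹ - c) := by
  ext i j
  rcases i with i | i <;> rcases j with j | j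
  · simp [blk, Matrix.one_apply, Matrix.sub_apply]
  · simp [blk, colv]
  · simp [blk, colv]
  · fin_cases i; fin_cases j; simp [blk]

/-- `colv (U u) = U · colv u`. [folklore] -/
theorem colv_mulVec (U : Matrix (Fin 3) (Fin 3) ℂ) (u : Fin 3 → ℂ) :
    colv (U *ᵥ u) = U * colv u := by
  ext i j
  simp [colv, Matrix.mul_apply, Matrix.mulVec, dotProduct]

/-- Conjugating the corner: `[[U D U*, U u], [(U u)*, c]] = W [[D, u], [u*, c]] W*`,
`W = diag(U, 1)`. [folklore] -/
theorem blk_conj (U D : Matrix (Fin 3) (Fin 3) ℂ) (u : Fin 3 → ℂ) (c : ℂ) :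
    blk (U * D * Uᴴ) (U *ᵥ u) c =
      Matrix.fromBlocks U 0 0 (1 : Matrix (Fin 1) (Fin 1) ℂ) * blk D u c *
        (Matrix.fromBlocks U 0 0 (1 : Matrix (Fin 1) (Fin 1) ℂ))ᴴ := by
  rw [blk, blk, Matrix.fromBlocks_conjTranspose, Matrix.fromBlocks_multiply,
    Matrix.fromBlocks_multiply, colv_mulVec]
  simp [Matrix.conjTranspose_mul, Matrix.mul_assoc]

/-- Positivity is invariant under conjugation by the unitary `diag(U, 1)`. [folklore] -/
theorem posSemidef_blk_conj_iff {U : Matrix (Fin 3) (Fin 3) ℂ} (hU : U ∈ Matrix.unitaryGroup (Fin 3) ℂ)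
    (D : Matrix (Fin 3) (Fin 3) ℂ) (u : Fin 3 → ℂ) (c : ℂ) :
    (blk (U * D * Uᴴ) (U *ᵥ u) c).PosSemidef ↔ (blk D u c).PosSemidef := by
  set W : Matrix (Fin 3 ⊕ Fin 1) (Fin 3 ⊕ Fin 1) ℂ := Matrix.fromBlocks U 0 0 1 with hW
  have hU1 : Uᴴ * U = 1 := Matrix.mem_unitaryGroup_iff'.mp hU
  have hW1 : Wᴴ * W = 1 := by
    rw [hW, Matrix.fromBlocks_conjTranspose, Matrix.fromBlocks_multiply]
    simp [hU1, Matrix.fromBlocks_one]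
  rw [blk_conj]
  constructor
  · intro h
    have h2 := h.conjTranspose_mul_mul_same W
    rwa [← Matrix.mul_assoc, ← Matrix.mul_assoc, hW1, Matrix.one_mul, Matrix.mul_assoc, hW1,
      Matrix.mul_one] at h2
  · intro h
    exact h.mul_mul_conjTranspose_same W

/-- A `1 × 1` complex matrix is positive semidefinite iff its entry is `≥ 0`. [folklore] -/
theorem posSemidef_fin_one_iff (a : ℂ) : (!![a] : Matrix (Fin 1) (Fin 1) ℂ).PosSemidef ↔ 0 ≤ a := by
  rw [Matrix.posSemidef_iff_dotProduct_mulVec]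
  constructor
  · rintro ⟨-, h⟩
    simpa [dotProduct, Matrix.mulVec] using h ![1]
  · intro ha
    refine ⟨?_, fun x => ?_⟩
    · refine Matrix.IsHermitian.ext fun i j => ?_
      fin_cases i; fin_cases j
      obtain ⟨r, hr⟩ : ∃ r : ℝ, (r : ℂ) = a := ⟨a.re, Complex.ext rfl (by simpa using (Complex.nonneg_iff.mp ha).2)⟩
      simp [← hr, Complex.conj_ofReal]
    · have : star x ⬝ᵥ (!![a] *ᵥ x) = a * (Complex.normSq (x 0) : ℂ) := by
        simp [dotProduct, Matrix.mulVec, Complex.normSq_eq_conj_mul_self]; ring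
      rw [this]
      exact mul_nonneg ha (by exact_mod_cast Complex.normSq_nonneg _)

/-- **Schur complement for a positive diagonal corner**:
`[[diag d, u], [u*, c]] ≽ 0 ⟺ Σ |uᵢ|²/dᵢ ≤ c`. [folklore] -/
theorem posSemidef_blk_diagonal_iff {d : Fin 3 → ℝ} (hd : ∀ i, 0 < d i) (u : Fin 3 → ℂ) (c : ℝ) :
    (blk (Matrix.diagonal fun i => ((d i : ℝ) : ℂ)) u c).PosSemidef ↔
      ∑ i, Complex.normSq (u i) / d i ≤ c := by
  have hA : (Matrix.diagonal fun i => ((d i : ℝ) : ℂ)).PosDef :=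
    Matrix.PosDef.diagonal fun i => by exact_mod_cast hd i
  haveI : Invertible (Matrix.diagonal fun i => ((d i : ℝ) : ℂ)) :=
    Matrix.invertibleOfIsUnitDet _ (by
      rw [Matrix.det_diagonal, isUnit_iff_ne_zero]
      exact Finset.prod_ne_zero_iff.mpr fun i _ => by exact_mod_cast (hd i).ne')
  have hinv : (Matrix.diagonal fun i => ((d i : ℝ) : ℂ))⁻¹ =
      Matrix.diagonal fun i => (((d i)⁻¹ : ℝ) : ℂ) := by
    refine Matrix.inv_eq_left_inv ?_
    rw [Matrix.diagonal_mul_diagonal, ← Matrix.diagonal_one]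
    congr 1
    funext i
    rw [← Complex.ofReal_mul, inv_mul_cancel₀ (hd i).ne', Complex.ofReal_one]
  rw [blk, Matrix.PosDef.fromBlocks₁₁ _ _ hA, hinv]
  have hentry : !![(c : ℂ)] - (colv u)ᴴ * Matrix.diagonal (fun i => (((d i)⁻¹ : ℝ) : ℂ)) * colv u =
      !![((c - ∑ i, Complex.normSq (u i) / d i : ℝ) : ℂ)] := by
    ext i j
    fin_cases i; fin_cases j
    simp [colv, Matrix.mul_apply, Matrix.diagonal, Fin.sum_univ_three, Complex.normSq_eq_conj_mul_self,
      div_eq_mul_inv]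
    ring
  rw [hentry, posSemidef_fin_one_iff]
  rw [show (0 : ℂ) ≤ ((c - ∑ i, Complex.normSq (u i) / d i : ℝ) : ℂ) ↔
      0 ≤ c - ∑ i, Complex.normSq (u i) / d i from Complex.zero_le_real]
  exact sub_nonneg

/-! ## A4. Rotation invariance and the section volume -/

/-- A unitary matrix has `|det|² = 1`. [folklore] -/
theorem normSq_det_of_mem_unitaryGroup {U : Matrix (Fin 3) (Fin 3) ℂ}
    (hU : U ∈ Matrix.unitaryGroup (Fin 3) ℂ) : Complex.normSq U.det = 1 := by
  have h : Uᴴ * U = 1 := Matrix.mem_unitaryGroup_iff'.mp hU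
  have hdet := congrArg Matrix.det h
  rw [Matrix.det_mul, Matrix.det_conjTranspose, Matrix.det_one] at hdet
  have : (Complex.normSq U.det : ℂ) = 1 := by
    rw [Complex.normSq_eq_conj_mul_self]; exact hdet
  exact_mod_cast this

/-- **Rotations by unitaries preserve Lebesgue measure on `ℂ³`** (`|det_ℝ U| = |det_ℂ U|² = 1`).
[folklore] -/
theorem volume_preimage_mulVec_unitary {U : Matrix (Fin 3) (Fin 3) ℂ}
    (hU : U ∈ Matrix.unitaryGroup (Fin 3) ℂ) (S : Set (Fin 3 → ℂ)) :
    volume ((fun v : Fin 3 → ℂ => U *ᵥ v) ⁻¹' S) = volume S := by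
  set f : (Fin 3 → ℂ) →ₗ[ℝ] (Fin 3 → ℂ) := (Matrix.toLin' U).restrictScalars ℝ with hf
  have hdet : LinearMap.det f = 1 := by
    rw [hf, LinearMap.det_restrictScalars, LinearMap.det_toLin', Algebra.norm_complex_apply,
      normSq_det_of_mem_unitaryGroup hU]
  have hpre : (fun v : Fin 3 → ℂ => U *ᵥ v) ⁻¹' S = f ⁻¹' S := by
    ext v; simp [hf, Matrix.toLin'_apply]
  rw [hpre, Measure.addHaar_preimage_linearMap volume (by rw [hdet]; exact one_ne_zero) S, hdet]
  simp

/-- The image of a set under a unitary rotation is the preimage under the inverse rotation.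
[folklore] -/
theorem image_mulVec_unitary {U : Matrix (Fin 3) (Fin 3) ℂ}
    (hU : U ∈ Matrix.unitaryGroup (Fin 3) ℂ) (S : Set (Fin 3 → ℂ)) :
    (fun u : Fin 3 → ℂ => U *ᵥ u) '' S = (fun v : Fin 3 → ℂ => Uᴴ *ᵥ v) ⁻¹' S := by
  have h1 : Uᴴ * U = 1 := Matrix.mem_unitaryGroup_iff'.mp hU
  have h2 : U * Uᴴ = 1 := Matrix.mem_unitaryGroup_iff.mp hU
  ext v
  constructor
  · rintro ⟨u, hu, rfl⟩
    simpa [Matrix.mulVec_mulVec, h1] using hu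
  · intro hv
    exact ⟨Uᴴ *ᵥ v, hv, by simp [Matrix.mulVec_mulVec, h2]⟩

/-- Volume of the image under a unitary rotation. [folklore] -/
theorem volume_image_mulVec_unitary {U : Matrix (Fin 3) (Fin 3) ℂ}
    (hU : U ∈ Matrix.unitaryGroup (Fin 3) ℂ) (S : Set (Fin 3 → ℂ)) :
    volume ((fun u : Fin 3 → ℂ => U *ᵥ u) '' S) = volume S := by
  rw [image_mulVec_unitary hU]
  exact volume_preimage_mulVec_unitary (Unitary.star_mem hU) S

/-- The Schur section over the corner `A` with corner entry `c`: border columns `v` with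
`0 ≼ [[A, v], [v*, c]] ≼ ½`. [folklore] -/
def schurSection (A : Matrix (Fin 3) (Fin 3) ℂ) (c : ℝ) : Set (Fin 3 → ℂ) :=
  {v | (blk A v c).PosSemidef ∧
    ((2 : ℂ)⁻¹ • (1 : Matrix (Fin 3 ⊕ Fin 1) (Fin 3 ⊕ Fin 1) ℂ) - blk A v c).PosSemidef}

/-- The diagonal corner with real spectrum `e`. [folklore] -/
def diag3 (e : Fin 3 → ℝ) : Matrix (Fin 3) (Fin 3) ℂ := Matrix.diagonal fun i => ((e i : ℝ) : ℂ)

/-- `½ − U diag(e) U* = U diag(½ − e) U*`. [folklore] -/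
theorem half_sub_conj_diag3 {U : Matrix (Fin 3) (Fin 3) ℂ} (hU : U ∈ Matrix.unitaryGroup (Fin 3) ℂ)
    (e : Fin 3 → ℝ) :
    (2 : ℂ)⁻¹ • (1 : Matrix (Fin 3) (Fin 3) ℂ) - U * diag3 e * Uᴴ =
      U * diag3 (fun i => 1 / 2 - e i) * Uᴴ := by
  have h2 : U * Uᴴ = 1 := Matrix.mem_unitaryGroup_iff.mp hU
  have hd : diag3 (fun i => 1 / 2 - e i) = (2 : ℂ)⁻¹ • 1 - diag3 e := by
    ext i j
    by_cases hij : i = j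
    · subst hij
      simp [diag3]
    · simp [diag3, hij]
  rw [hd, Matrix.mul_sub, Matrix.sub_mul, Matrix.mul_smul, Matrix.mul_one, Matrix.smul_mul, h2]

/-- **The Schur section in the eigenbasis**: for `ρ₃ = U diag(e) U*` with `0 < eᵢ < ½`, the section
`{v : 0 ≼ [[ρ₃, v], [v*, c]] ≼ ½}` is the `U`-rotate of
`{u : Σ |uᵢ|²/eᵢ ≤ c ∧ Σ |uᵢ|²/(½ − eᵢ) ≤ ½ − c}`. [folklore] -/
theorem schurSection_eq {U : Matrix (Fin 3) (Fin 3) ℂ} (hU : U ∈ Matrix.unitaryGroup (Fin 3) ℂ)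
    {e : Fin 3 → ℝ} (he0 : ∀ i, 0 < e i) (he1 : ∀ i, e i < 1 / 2) (c : ℝ) :
    schurSection (U * diag3 e * Uᴴ) c =
      (fun u : Fin 3 → ℂ => U *ᵥ u) ''
        {u | ∑ i, Complex.normSq (u i) / e i ≤ c ∧
          ∑ i, Complex.normSq (u i) / (1 / 2 - e i) ≤ 1 / 2 - c} := by
  have h1 : Uᴴ * U = 1 := Matrix.mem_unitaryGroup_iff'.mp hU
  have h2 : U * Uᴴ = 1 := Matrix.mem_unitaryGroup_iff.mp hU
  have he1' : ∀ i, 0 < 1 / 2 - e i := fun i => by linarith [he1 i]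
  rw [image_mulVec_unitary hU]
  ext v
  simp only [schurSection, mem_setOf_eq, mem_preimage]
  -- write `v = U u`
  have hv : v = U *ᵥ (Uᴴ *ᵥ v) := by simp [Matrix.mulVec_mulVec, h2]
  set u := Uᴴ *ᵥ v with hu
  rw [hv]
  rw [posSemidef_blk_conj_iff hU, half_sub_blk, half_sub_conj_diag3 hU,
    show -(U *ᵥ u) = U *ᵥ (-u) from (Matrix.mulVec_neg _ _).symm, posSemidef_blk_conj_iff hU,
    show ((2 : ℂ)⁻¹ - (c : ℂ)) = (((1 / 2 - c : ℝ)) : ℂ) by push_cast; ring]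
  rw [diag3, diag3, posSemidef_blk_diagonal_iff he0, posSemidef_blk_diagonal_iff he1']
  simp only [Pi.neg_apply, Complex.normSq_neg]

/-- **Volume of the Schur section** (step A of the secular peeling): for `ρ₃ = U diag(e) U*` with
`0 < eᵢ < ½` and any real `c`,
`vol₆ {v ∈ ℂ³ : 0 ≼ [[ρ₃, v], [v*, c]] ≼ ½} = π³ · vol₃ (cutSimplex e c)`. [folklore] -/
theorem volume_schurSection {U : Matrix (Fin 3) (Fin 3) ℂ} (hU : U ∈ Matrix.unitaryGroup (Fin 3) ℂ)
    {e : Fin 3 → ℝ} (he0 : ∀ i, 0 < e i) (he1 : ∀ i, e i < 1 / 2) (c : ℝ) :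
    volume (schurSection (U * diag3 e * Uᴴ) c) =
      ENNReal.ofReal π ^ 3 * volume (cutSimplex e c) := by
  rw [schurSection_eq hU he0 he1, volume_image_mulVec_unitary hU]
  set T : Set (Fin 3 → ℝ) :=
    {s | ∑ i, s i / e i ≤ c ∧ ∑ i, s i / (1 / 2 - e i) ≤ 1 / 2 - c} with hT
  have hTm : MeasurableSet T := by
    have h2 : MeasurableSet {s : Fin 3 → ℝ | ∑ i, s i / e i ≤ c} :=
      measurableSet_le (Finset.measurable_sum _ fun i _ => (measurable_pi_apply i).div_const _)
        measurable_const
    have h3 : MeasurableSet {s : Fin 3 → ℝ | ∑ i, s i / (1 / 2 - e i) ≤ 1 / 2 - c} :=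
      measurableSet_le (Finset.measurable_sum _ fun i _ => (measurable_pi_apply i).div_const _)
        measurable_const
    rw [hT, Set.setOf_and]; exact h2.inter h3
  have hpre : {u : Fin 3 → ℂ | ∑ i, Complex.normSq (u i) / e i ≤ c ∧
      ∑ i, Complex.normSq (u i) / (1 / 2 - e i) ≤ 1 / 2 - c} = normSqPi ⁻¹' T := by
    ext u; simp [hT, normSqPi]
  rw [hpre, volume_normSqPi_preimage hTm]
  congr 1
  rw [← volume_cutSimplex_inter_pos]
  congr 1
  ext s
  simp only [hT, cutSimplex, mem_inter_iff, mem_setOf_eq, mem_univ_pi, mem_Ioi]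
  constructor
  · rintro ⟨⟨ha, hb⟩, hp⟩; exact ⟨⟨fun i => (hp i).le, ha, hb⟩, hp⟩
  · rintro ⟨⟨-, ha, hb⟩, hp⟩; exact ⟨⟨ha, hb⟩, hp⟩

end ZhangJiangXie2025

end Literature.Probability.RandomMatrix

end
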